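import Summits.ResolutionOfSingularities.ResolutionOfSingularities.Theses.Valuative
import Literature.AlgebraicGeometry.Resolution.LocalUniformization
import Literature.AlgebraicGeometry.Resolution.ToricUniformization
import HarnessLib

/-!
# Route `Valuative`, item `Lupi` (stmt-ResolutionOfSingularities-0560): the Laurent base

`Lupi` (LUPI_p) concerns `K = k(x₁,…,xₙ,t)` with `x` algebraically independent over a field `k`
of characteristic `p` and `t ^ p ∈ k[x]` (the function field of the Zariski hypersurface
`t^p = f(x)`), and asks that every valuation ring `O ⊇ k` of `K` be locally uniformizable over
`k`.  This file supplies the elementary field theory of such a datum and the one construction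
every reduction of the item uses:

* `isAlgebraic_adjoin_range`, `trdeg_eq` — `K` is algebraic over `k[x]`, `trdeg_k K = n`.
* **The Laurent base.** For a valuation ring `O` and the `O`-adapted family `y`
  (`yᵢ = xᵢ` if `xᵢ ∈ O`, else `xᵢ⁻¹`; `exists_eq_or_eq_inv_mem`): `y` is algebraically
  independent (`algebraicIndependent_of_eq_or_eq_inv`: it has `trdeg_k K` members and `K` is
  algebraic over `k[y]`, Mathlib's `isTranscendenceBasis_of_le_trdeg_of_finite`), so
  `k[y] ⊆ O` is a polynomial ring and REGULAR at the centre of `O`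
  (`isRegularLocalRing_centre_adjoin_range`); and denominators clear into it:
  `u ^ m * f ∈ k[y]` for `u = ∏ yᵢ`, `f ∈ k[x]` (`exists_pow_mul_mem_adjoin`).
* `exists_datum_mem` — **normal form of the datum along `O`**: there are `y ⊆ O` algebraically
  independent and `t' = u ^ m * t` with `t' ^ p ∈ k[y]` and `K = k(y, t')`; i.e. without loss of
  generality the centre of `O` lies on the chart `k[x]`.

Consumers: `ValuativeLupi.lean` (`Lupi` from the crux `LuAlphaPTorsor`, the rational case, the
normal form `lupi_iff_mem`).

Log: (1) direct, Mathlib transcendence-basis API + `IsAlgebraic.adjoin_of_forall_isAlgebraic`.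
-/

-- single-problem summit: the doubled namespace component `ResolutionOfSingularities` is forced
set_option linter.dupNamespace false

open IsLocalRing

namespace Summit.ResolutionOfSingularities.ResolutionOfSingularities.Theorems.Lupi

open Literature.AlgebraicGeometry.Resolution

/-! ## Field-theoretic preliminaries on the datum `(x, t)` -/

section Datum

variable {k K : Type} [Field k] [Field K] [Algebra k K]

/-- `K = k(x, t)` is finitely generated over `k`. -/
theorem fg_top_of_adjoin_eq_top {n : ℕ} (x : Fin n → K) (t : K)
    (htop : IntermediateField.adjoin k (insert t (Set.range x)) = ⊤) :
    (⊤ : IntermediateField k K).FG := by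
  classical
  refine ⟨insert t (Finset.univ.image x), ?_⟩
  rw [Finset.coe_insert, Finset.coe_image, Finset.coe_univ, Set.image_univ, htop]

/-- Every element of `k(s)` is algebraic over `k[s]`. -/
theorem isAlgebraic_adjoin_of_mem_adjoin {s : Set K} {a : K}
    (ha : a ∈ IntermediateField.adjoin k s) : IsAlgebraic (Algebra.adjoin k s) a := by
  obtain ⟨r, hr, q, hq, rfl⟩ := IntermediateField.mem_adjoin_iff_div.mp ha
  rw [div_eq_mul_inv]
  exact (isAlgebraic_algebraMap (⟨r, hr⟩ : Algebra.adjoin k s)).mul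
    (IsAlgebraic.inv_iff.mpr (isAlgebraic_algebraMap (⟨q, hq⟩ : Algebra.adjoin k s)))

/-- If `Frac`-generators of `K` over `k` lie in the subfield generated by a subalgebra `R`
(`k(R) = K`), then `Frac R = K`. -/
theorem isFractionRing_of_adjoin_eq_top (R : Subalgebra k K)
    (h : IntermediateField.adjoin k (R : Set K) = ⊤) : IsFractionRing R K := by
  refine IsFractionRing.of_field R K fun z => ?_
  have hz : z ∈ IntermediateField.adjoin k (R : Set K) := by rw [h]; exact IntermediateField.mem_top
  obtain ⟨a, ha, b, hb, rfl⟩ := IntermediateField.mem_adjoin_iff_div.mp hz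
  rw [Algebra.adjoin_eq] at ha hb
  exact ⟨⟨a, ha⟩, ⟨b, hb⟩, rfl⟩

/-- `k(s, t) = K` gives `Frac (k[s][t]) = K`. -/
theorem isFractionRing_adjoin_insert_of_adjoin_eq_top (s : Set K) (t : K)
    (htop : IntermediateField.adjoin k (insert t s) = ⊤) :
    IsFractionRing (Algebra.adjoin k (insert t (Algebra.adjoin k s : Set K))) K := by
  rw [Algebra.adjoin_insert_adjoin]
  apply isFractionRing_of_adjoin_eq_top
  apply top_le_iff.mp
  rw [← htop, IntermediateField.adjoin_le_iff]
  exact fun z hz => IntermediateField.subset_adjoin k _ (Algebra.subset_adjoin hz)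

/-- If `t ^ p ∈ k[x]` (`p ≠ 0`) and `K = k(x, t)`, then `K` is algebraic over `k[x]`. -/
theorem isAlgebraic_adjoin_range {n : ℕ} (x : Fin n → K) (t : K) {p : ℕ} (hp : p ≠ 0)
    (htp : t ^ p ∈ Algebra.adjoin k (Set.range x))
    (htop : IntermediateField.adjoin k (insert t (Set.range x)) = ⊤) :
    Algebra.IsAlgebraic (Algebra.adjoin k (Set.range x)) K := by
  refine ⟨fun a => ?_⟩
  have ha : IsAlgebraic (Algebra.adjoin k (insert t (Set.range x))) a :=
    isAlgebraic_adjoin_of_mem_adjoin (by rw [htop]; exact IntermediateField.mem_top)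
  refine ha.adjoin_of_forall_isAlgebraic fun z hz => ?_
  rcases hz.1 with rfl | ⟨i, rfl⟩
  · exact IsAlgebraic.of_pow (Nat.pos_of_ne_zero hp)
      (isAlgebraic_algebraMap (⟨z ^ p, htp⟩ : Algebra.adjoin k (Set.range x)))
  · exact isAlgebraic_algebraMap (⟨x i, Algebra.subset_adjoin ⟨i, rfl⟩⟩ :
      Algebra.adjoin k (Set.range x))

/-- With `x` algebraically independent, `t ^ p ∈ k[x]` (`p ≠ 0`) and `K = k(x, t)`:
`trdeg_k K = n`. -/
theorem trdeg_eq {n : ℕ} (x : Fin n → K) (t : K) {p : ℕ} (hp : p ≠ 0)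
    (hx : AlgebraicIndependent k x) (htp : t ^ p ∈ Algebra.adjoin k (Set.range x))
    (htop : IntermediateField.adjoin k (insert t (Set.range x)) = ⊤) :
    Algebra.trdeg k K = n := by
  haveI := isAlgebraic_adjoin_range x t hp htp htop
  have hB : IsTranscendenceBasis k x := hx.isTranscendenceBasis_iff_isAlgebraic.mpr inferInstance
  rw [← hB.cardinalMk_eq_trdeg, Cardinal.mk_fin]

end Datum

/-! ## The Laurent base `k[y] ⊆ O`, `yᵢ ∈ {xᵢ, xᵢ⁻¹}` -/

section LaurentBase

variable {k K : Type} [Field k] [Field K] [Algebra k K]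

/-- For every valuation ring `O` there is an `O`-adapted inversion `y` of `x`: `yᵢ ∈ O` and
`yᵢ = xᵢ` or `yᵢ = xᵢ⁻¹`. -/
theorem exists_eq_or_eq_inv_mem (O : ValuationSubring K) {n : ℕ} (x : Fin n → K) :
    ∃ y : Fin n → K, (∀ i, y i ∈ O) ∧ ∀ i, y i = x i ∨ y i = (x i)⁻¹ := by
  classical
  refine ⟨fun i => if x i ∈ O then x i else (x i)⁻¹, fun i => ?_, fun i => ?_⟩
  · by_cases h : x i ∈ O
    · simp only [h, if_true]
    · simp only [h, if_false]
      exact (O.mem_or_inv_mem (x i)).resolve_left h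
  · by_cases h : x i ∈ O
    · exact Or.inl (by simp only [h, if_true])
    · exact Or.inr (by simp only [h, if_false])

/-- `k[y] ⊆ O` when `k ⊆ O` and every `yᵢ ∈ O`. -/
theorem adjoin_range_toSubring_le (O : ValuationSubring K) (hO : ∀ c : k, algebraMap k K c ∈ O)
    {n : ℕ} {y : Fin n → K} (hyO : ∀ i, y i ∈ O) :
    (Algebra.adjoin k (Set.range y)).toSubring ≤ O.toSubring := by
  let Oalg : Subalgebra k K := { O.toSubring with algebraMap_mem' := hO }
  change Algebra.adjoin k (Set.range y) ≤ Oalg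
  exact Algebra.adjoin_le (by rintro _ ⟨i, rfl⟩; exact hyO i)

/-- Each `xᵢ` is algebraic over `k[y]` (it is `yᵢ` or `yᵢ⁻¹`). -/
theorem isAlgebraic_adjoin_range_of_eq_or_eq_inv {n : ℕ} {x y : Fin n → K}
    (hy : ∀ i, y i = x i ∨ y i = (x i)⁻¹) (i : Fin n) :
    IsAlgebraic (Algebra.adjoin k (Set.range y)) (x i) := by
  have hyi : IsAlgebraic (Algebra.adjoin k (Set.range y)) (y i) :=
    isAlgebraic_algebraMap (⟨y i, Algebra.subset_adjoin ⟨i, rfl⟩⟩ : Algebra.adjoin k (Set.range y))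
  rcases hy i with h | h
  · rwa [h] at hyi
  · rw [← inv_inv (x i), ← h]
    exact IsAlgebraic.inv_iff.mpr hyi

/-- If `K` is algebraic over `k[x]`, it is algebraic over `k[y]`. -/
theorem isAlgebraic_adjoin_range_inv {n : ℕ} {x y : Fin n → K}
    (hy : ∀ i, y i = x i ∨ y i = (x i)⁻¹)
    (halg : Algebra.IsAlgebraic (Algebra.adjoin k (Set.range x)) K) :
    Algebra.IsAlgebraic (Algebra.adjoin k (Set.range y)) K := by
  refine ⟨fun a => (halg.isAlgebraic a).adjoin_of_forall_isAlgebraic fun z hz => ?_⟩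
  obtain ⟨i, rfl⟩ := hz.1
  exact isAlgebraic_adjoin_range_of_eq_or_eq_inv hy i

/-- **The Laurent base is algebraically independent**: if `x` is algebraically independent with
`K` algebraic over `k[x]`, so is every family `y` with `yᵢ ∈ {xᵢ, xᵢ⁻¹}` (it has `trdeg_k K`
members and `K` is algebraic over `k[y]`). -/
theorem algebraicIndependent_of_eq_or_eq_inv {n : ℕ} {x y : Fin n → K}
    (hx : AlgebraicIndependent k x) (halg : Algebra.IsAlgebraic (Algebra.adjoin k (Set.range x)) K)
    (hy : ∀ i, y i = x i ∨ y i = (x i)⁻¹) : AlgebraicIndependent k y := by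
  haveI : FaithfulSMul k K :=
    (faithfulSMul_iff_algebraMap_injective k K).mpr (algebraMap k K).injective
  haveI := isAlgebraic_adjoin_range_inv hy halg
  exact (Algebra.IsAlgebraic.isTranscendenceBasis_of_le_trdeg_of_finite k y
    hx.cardinalMk_le_trdeg).1

/-- `k[y]` is finitely generated. -/
theorem fg_adjoin_range {n : ℕ} (y : Fin n → K) : (Algebra.adjoin k (Set.range y)).FG := by
  classical
  refine ⟨Finset.univ.image y, ?_⟩
  rw [Finset.coe_image, Finset.coe_univ, Set.image_univ]

/-- **`k[y]` is a regular ring** (a polynomial ring over a field) for `y` algebraically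
independent, hence regular at the centre of any valuation ring containing it. -/
theorem isRegularLocalRing_centre_adjoin_range (O : ValuationSubring K) {n : ℕ} {y : Fin n → K}
    (hy : AlgebraicIndependent k y)
    (h₀ : (Algebra.adjoin k (Set.range y)).toSubring ≤ O.toSubring) :
    IsRegularLocalRing (Localization.AtPrime
      (Ideal.comap (Subring.inclusion h₀) (IsLocalRing.maximalIdeal O))) := by
  haveI : IsRegularRing ↥(Algebra.adjoin k (Set.range y)) :=
    isRegularRing_adjoin_of_algebraicIndependent y hy
  change IsRegularLocalRing (Localization.AtPrime (centreIdeal (Algebra.adjoin k (Set.range y)) O h₀))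
  infer_instance

/-- Every `xᵢ` lies in an intermediate field `F` as soon as the `O`-adapted `yᵢ` does. -/
theorem mem_of_eq_or_eq_inv {n : ℕ} {x y : Fin n → K}
    (hy : ∀ i, y i = x i ∨ y i = (x i)⁻¹) {F : IntermediateField k K}
    (hyF : ∀ i, y i ∈ F) (i : Fin n) : x i ∈ F := by
  rcases hy i with h | h
  · exact h ▸ hyF i
  · rw [← inv_inv (x i), ← h]
    exact inv_mem (hyF i)

/-- **Clearing denominators into the Laurent base**: with `u = ∏ yᵢ` and all `xᵢ ≠ 0`, every
`f ∈ k[x]` satisfies `u ^ m * f ∈ k[y]` for some `m`. -/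
theorem exists_pow_mul_mem_adjoin {n : ℕ} {x y : Fin n → K} (hx0 : ∀ i, x i ≠ 0)
    (hy : ∀ i, y i = x i ∨ y i = (x i)⁻¹) {f : K} (hf : f ∈ Algebra.adjoin k (Set.range x)) :
    ∃ m : ℕ, (∏ i, y i) ^ m * f ∈ Algebra.adjoin k (Set.range y) := by
  classical
  set A₀ : Subalgebra k K := Algebra.adjoin k (Set.range y) with hA₀
  have hyA : ∀ i, y i ∈ A₀ := fun i => Algebra.subset_adjoin ⟨i, rfl⟩
  have huA : (∏ i, y i) ∈ A₀ := prod_mem fun i _ => hyA i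
  induction hf using Algebra.adjoin_induction with
  | mem z hz =>
    obtain ⟨i, rfl⟩ := hz
    refine ⟨1, ?_⟩
    rw [pow_one, ← Finset.prod_erase_mul _ _ (Finset.mem_univ i), mul_assoc]
    refine mul_mem (prod_mem fun j _ => hyA j) ?_
    rcases hy i with h | h
    · rw [h]; exact mul_mem (h ▸ hyA i) (h ▸ hyA i)
    · rw [h, inv_mul_cancel₀ (hx0 i)]; exact one_mem _
  | algebraMap c => exact ⟨0, by rw [pow_zero, one_mul]; exact A₀.algebraMap_mem c⟩
  | add a b _ _ iha ihb =>
    obtain ⟨m₁, h₁⟩ := iha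
    obtain ⟨m₂, h₂⟩ := ihb
    refine ⟨m₁ + m₂, ?_⟩
    have : (∏ i, y i) ^ (m₁ + m₂) * (a + b) =
        (∏ i, y i) ^ m₂ * ((∏ i, y i) ^ m₁ * a) + (∏ i, y i) ^ m₁ * ((∏ i, y i) ^ m₂ * b) := by
      ring
    rw [this]
    exact add_mem (mul_mem (pow_mem huA _) h₁) (mul_mem (pow_mem huA _) h₂)
  | mul a b _ _ iha ihb =>
    obtain ⟨m₁, h₁⟩ := iha
    obtain ⟨m₂, h₂⟩ := ihb
    refine ⟨m₁ + m₂, ?_⟩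
    have : (∏ i, y i) ^ (m₁ + m₂) * (a * b) =
        ((∏ i, y i) ^ m₁ * a) * ((∏ i, y i) ^ m₂ * b) := by ring
    rw [this]
    exact mul_mem h₁ h₂

/-- **Normal form of the datum along `O`.** For `x` algebraically independent, `t ^ p ∈ k[x]`
(`p ≠ 0`), `K = k(x, t)` and any valuation ring `O`: there are `y` INSIDE `O`, algebraically
independent, and `t'` (namely `yᵢ ∈ {xᵢ, xᵢ⁻¹}`, `t' = (∏ yᵢ) ^ m * t`) with `t' ^ p ∈ k[y]` and
`K = k(y, t')`.  So in `Lupi` one may assume the centre of `O` lies on the chart `k[x]`. -/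
theorem exists_datum_mem {n : ℕ} (x : Fin n → K) (t : K) {p : ℕ} (hp : p ≠ 0)
    (hx : AlgebraicIndependent k x) (htp : t ^ p ∈ Algebra.adjoin k (Set.range x))
    (htop : IntermediateField.adjoin k (insert t (Set.range x)) = ⊤) (O : ValuationSubring K) :
    ∃ (y : Fin n → K) (t' : K), (∀ i, y i ∈ O) ∧ AlgebraicIndependent k y ∧
      t' ^ p ∈ Algebra.adjoin k (Set.range y) ∧
      IntermediateField.adjoin k (insert t' (Set.range y)) = ⊤ := by
  classical
  obtain ⟨y, hyO, hy⟩ := exists_eq_or_eq_inv_mem O x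
  have halg := isAlgebraic_adjoin_range x t hp htp htop
  have hyind : AlgebraicIndependent k y := algebraicIndependent_of_eq_or_eq_inv hx halg hy
  set A₀ : Subalgebra k K := Algebra.adjoin k (Set.range y) with hA₀
  have hx0 : ∀ i, x i ≠ 0 := fun i => hx.ne_zero i
  have hy0 : ∀ i, y i ≠ 0 := fun i => by
    rcases hy i with h | h
    · exact h ▸ hx0 i
    · exact h ▸ inv_ne_zero (hx0 i)
  set u : K := ∏ i, y i with hu
  have hu0 : u ≠ 0 := Finset.prod_ne_zero_iff.mpr fun i _ => hy0 i
  have hyA : ∀ i, y i ∈ A₀ := fun i => Algebra.subset_adjoin ⟨i, rfl⟩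
  have huA : u ∈ A₀ := prod_mem fun i _ => hyA i
  obtain ⟨m, hm⟩ := exists_pow_mul_mem_adjoin hx0 hy htp
  refine ⟨y, u ^ m * t, hyO, hyind, ?_, ?_⟩
  · -- `t' ^ p = (u^m)^(p-1) * (u^m * t^p) ∈ k[y]`
    have : (u ^ m * t) ^ p = (u ^ m) ^ (p - 1) * (u ^ m * t ^ p) := by
      rw [mul_pow, ← mul_assoc, ← pow_succ, Nat.sub_add_cancel (Nat.pos_of_ne_zero hp)]
    rw [this]
    exact mul_mem (pow_mem (pow_mem huA _) _) hm
  · -- `k(y, t') ∋ xᵢ, t`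
    apply top_le_iff.mp
    rw [← htop, IntermediateField.adjoin_le_iff]
    set F := IntermediateField.adjoin k (insert (u ^ m * t) (Set.range y)) with hF
    have hyF : ∀ i, y i ∈ F := fun i =>
      IntermediateField.subset_adjoin k _ (Set.mem_insert_of_mem _ ⟨i, rfl⟩)
    have huF : u ^ m ∈ F := pow_mem (prod_mem fun i _ => hyF i) _
    have ht'F : u ^ m * t ∈ F := IntermediateField.subset_adjoin k _ (Set.mem_insert _ _)
    rintro z (rfl | ⟨i, rfl⟩)
    · have : z = (u ^ m)⁻¹ * (u ^ m * z) := by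
        rw [← mul_assoc, inv_mul_cancel₀ (pow_ne_zero _ hu0), one_mul]
      rw [this]
      exact mul_mem (inv_mem huF) ht'F
    · exact mem_of_eq_or_eq_inv hy hyF i

end LaurentBase

end Summit.ResolutionOfSingularities.ResolutionOfSingularities.Theorems.Lupi
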